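import Mathlib
import Summits.Ventures.PercRepro2.Tail2DBlockCalc
import Summits.Ventures.PercRepro2.Tail2DHarrisSP
import Summits.Ventures.PercRepro2.Tail2DFlowOneBlocks
import Summits.Ventures.PercRepro2.Tail2DFlowOneStep01
import Summits.Ventures.PercRepro2.Tail2DParFin
import Summits.Ventures.PercRepro2.Tail2DParFinFlip
import Summits.Ventures.PercRepro2.Tail2DParFinTop

/-!
# Words of `k` flow-one factors: the `C`-set, the fibres over (`C`-set, number of blues) and their masses
(seat mine-b, cell pub-perc-repro2; conjectures/MINE-B.md §44)

A word `w : Fin k → Ltr` is determined by its `C`-set and its blue set (`mkWord3`); the block of a word has size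
`Π_{i ∈ cSet} #C_i · Π_{i ∉ cSet} #R_i` (the red and blue classes of a factor have the same size), so the words
with a given `C`-set `S` and exactly `j` blues have a common block size and there are `C(k − #S, j)` of them
(`sum_fibre`).  At the SUB-TOP level `u + v + 1 = k` a tail word has at most one `C`, which gives the closed forms
`|E(u,v)| = A (C(k,v) + C(k,v+1)) + Γ̃ C(k−1,v)` with `A = Π #R_i` and `Γ̃ = Σ_l #C_l Π_{i ≠ l} #R_i`
(`tailCount_subtop`).
-/

namespace Summit.Ventures.PercRepro2.Tail2D

open V2Closure Finset

section CSet

variable (k : ℕ)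

/-- the positions of a word carrying `C` -/
def cSet (w : Fin k → Ltr) : Finset (Fin k) := Finset.univ.filter (fun i => w i = Ltr.C)

/-- the number of `C`s of a word -/
def nC (w : Fin k → Ltr) : ℕ := (cSet k w).card

/-- the letters of a word are reds, blues and `C`s -/
theorem nR_add_nB_add_nC (w : Fin k → Ltr) : nR k w + nB k w + nC k w = k := by
  unfold nR nB nC cSet
  rw [Finset.card_filter, Finset.card_filter, Finset.card_filter, ← Finset.sum_add_distrib,
    ← Finset.sum_add_distrib]
  have h : ∀ i : Fin k, ((if w i = Ltr.R then 1 else 0) + (if w i = Ltr.B then 1 else 0)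
      + (if w i = Ltr.C then 1 else 0)) = 1 := by
    intro i
    cases hw : w i <;> simp
  simp only [h, Finset.sum_const, Finset.card_univ, Fintype.card_fin, smul_eq_mul, mul_one]

/-- the word with `C` on `S`, `B` on `β` and `R` elsewhere -/
def mkWord3 (S β : Finset (Fin k)) : Fin k → Ltr :=
  fun i => if i ∈ S then Ltr.C else if i ∈ β then Ltr.B else Ltr.R

/-- the `C`-set of `mkWord3 S β` is `S` -/
theorem cSet_mkWord3 (S β : Finset (Fin k)) : cSet k (mkWord3 k S β) = S := by
  ext i
  simp only [cSet, mkWord3, Finset.mem_filter, Finset.mem_univ, true_and]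
  by_cases hS : i ∈ S
  · simp [hS]
  · by_cases hb : i ∈ β <;> simp [hS, hb]

/-- the blue set of `mkWord3 S β` is `β` when `β` avoids `S` -/
theorem blueSet_mkWord3 (S β : Finset (Fin k)) (h : β ⊆ Sᶜ) : blueSet k (mkWord3 k S β) = β := by
  ext i
  simp only [blueSet, mkWord3, Finset.mem_filter, Finset.mem_univ, true_and]
  by_cases hS : i ∈ S
  · have : i ∉ β := fun hb => (Finset.mem_compl.1 (h hb)) hS
    simp [hS, this]
  · by_cases hb : i ∈ β <;> simp [hS, hb]

/-- every word is the word of its `C`-set and its blue set -/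
theorem eq_mkWord3 (w : Fin k → Ltr) : w = mkWord3 k (cSet k w) (blueSet k w) := by
  ext i
  simp only [mkWord3, cSet, blueSet, Finset.mem_filter, Finset.mem_univ, true_and]
  cases hw : w i <;> simp

/-- the blue set of a word avoids its `C`-set -/
theorem blueSet_sub_compl_cSet (w : Fin k → Ltr) : blueSet k w ⊆ (cSet k w)ᶜ := by
  intro i hi
  simp only [blueSet, Finset.mem_filter, Finset.mem_univ, true_and] at hi
  simp only [cSet, Finset.mem_compl, Finset.mem_filter, Finset.mem_univ, true_and, hi]
  exact Ltr.noConfusion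

/-- the words with `C`-set `S` and exactly `j` blues are the images of the `j`-subsets of `Sᶜ` -/
theorem filter_cSet_nB_eq_image (S : Finset (Fin k)) (j : ℕ) :
    (Finset.univ.filter (fun w : Fin k → Ltr => cSet k w = S ∧ nB k w = j))
      = (Sᶜ.powersetCard j).image (mkWord3 k S) := by
  ext w
  simp only [Finset.mem_filter, Finset.mem_univ, true_and, Finset.mem_image, Finset.mem_powersetCard]
  constructor
  · rintro ⟨h1, h2⟩
    refine ⟨blueSet k w, ⟨?_, ?_⟩, ?_⟩
    · rw [← h1]; exact blueSet_sub_compl_cSet k w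
    · rw [← nB_eq_card_blueSet, h2]
    · rw [← h1]; exact (eq_mkWord3 k w).symm
  · rintro ⟨β, ⟨hβ, hc⟩, rfl⟩
    exact ⟨cSet_mkWord3 k S β, by rw [nB_eq_card_blueSet, blueSet_mkWord3 k S β hβ, hc]⟩

/-- `mkWord3 S` is injective on the subsets of `Sᶜ` -/
theorem mkWord3_injOn (S : Finset (Fin k)) (j : ℕ) : Set.InjOn (mkWord3 k S) (Sᶜ.powersetCard j) := by
  intro β hβ β' hβ' h
  rw [Finset.mem_coe, Finset.mem_powersetCard] at hβ hβ'
  rw [← blueSet_mkWord3 k S β hβ.1, ← blueSet_mkWord3 k S β' hβ'.1, h]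

/-- the number of words with `C`-set `S` and exactly `j` blues is `C(k − #S, j)` -/
theorem card_filter_cSet_nB (S : Finset (Fin k)) (j : ℕ) :
    (Finset.univ.filter (fun w : Fin k → Ltr => cSet k w = S ∧ nB k w = j)).card = (k - S.card).choose j := by
  rw [filter_cSet_nB_eq_image, Finset.card_image_of_injOn (mkWord3_injOn k S j), Finset.card_powersetCard,
    Finset.card_compl, Fintype.card_fin]

end CSet

section Masses

variable (k : ℕ) (X : Fin k → V2Closure.SP)

/-- the size of the block of a word: `Π_{i ∈ cSet} #C_i · Π_{i ∉ cSet} #R_i` -/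
theorem card_blockOf_cSet (w : Fin k → Ltr) :
    (blockOf k X w).card = (∏ i ∈ cSet k w, (cellSet (X i)).card) * ∏ i ∈ (cSet k w)ᶜ, (rSet (X i)).card := by
  rw [card_blockOf, ← Finset.prod_mul_prod_compl (cSet k w)]
  congr 1
  · refine Finset.prod_congr rfl (fun i hi => ?_)
    simp only [cSet, Finset.mem_filter, Finset.mem_univ, true_and] at hi
    rw [hi]; rfl
  · refine Finset.prod_congr rfl (fun i hi => ?_)
    simp only [cSet, Finset.mem_compl, Finset.mem_filter, Finset.mem_univ, true_and] at hi
    cases hw : w i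
    · rfl
    · exact (card_letterSet_R_eq_B (X i)).symm
    · exact absurd hw hi

/-- the mass of the words with `C`-set `S` and exactly `j` blues -/
theorem sum_fibre (S : Finset (Fin k)) (j : ℕ) :
    ∑ w ∈ Finset.univ.filter (fun w : Fin k → Ltr => cSet k w = S ∧ nB k w = j), ((blockOf k X w).card : ℚ)
      = ((k - S.card).choose j : ℚ) * ((∏ i ∈ S, ((cellSet (X i)).card : ℚ)) * ∏ i ∈ Sᶜ, ((rSet (X i)).card : ℚ)) := by
  have hconst : ∀ w ∈ Finset.univ.filter (fun w : Fin k → Ltr => cSet k w = S ∧ nB k w = j),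
      ((blockOf k X w).card : ℚ) = (∏ i ∈ S, ((cellSet (X i)).card : ℚ)) * ∏ i ∈ Sᶜ, ((rSet (X i)).card : ℚ) := by
    intro w hw
    simp only [Finset.mem_filter, Finset.mem_univ, true_and] at hw
    rw [card_blockOf_cSet, hw.1]
    push_cast
    rfl
  rw [Finset.sum_congr rfl hconst, Finset.sum_const, card_filter_cSet_nB, nsmul_eq_mul]

end Masses

section SubTop

variable (k : ℕ) (X : Fin k → V2Closure.SP)

/-- `A = Π #R_i` -/
noncomputable def massA : ℚ := ∏ i, ((rSet (X i)).card : ℚ)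

/-- `Γ̃ = Σ_l #C_l · Π_{i ≠ l} #R_i` -/
noncomputable def massG : ℚ := ∑ l, ((cellSet (X l)).card : ℚ) * ∏ i ∈ ({l} : Finset (Fin k))ᶜ, ((rSet (X i)).card : ℚ)

/-- a tail word at the sub-top level has no `C` and `v` or `v+1` blues, or exactly one `C` and `v` blues -/
theorem subtop_cases (u v : ℕ) (hk : u + v + 1 = k) (w : Fin k → Ltr) :
    (u ≤ nR k w ∧ v ≤ nB k w) ↔
      ((cSet k w = ∅ ∧ nB k w = v) ∨ (cSet k w = ∅ ∧ nB k w = v + 1) ∨ (∃ l, cSet k w = {l} ∧ nB k w = v)) := by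
  have h3 := nR_add_nB_add_nC k w
  constructor
  · rintro ⟨h1, h2⟩
    have hC : nC k w ≤ 1 := by omega
    rcases Nat.le_one_iff_eq_zero_or_eq_one.1 hC with h0 | h1'
    · have he : cSet k w = ∅ := Finset.card_eq_zero.1 h0
      have : nB k w = v ∨ nB k w = v + 1 := by omega
      rcases this with h | h
      · exact Or.inl ⟨he, h⟩
      · exact Or.inr (Or.inl ⟨he, h⟩)
    · obtain ⟨l, hl⟩ := Finset.card_eq_one.1 h1'
      refine Or.inr (Or.inr ⟨l, hl, ?_⟩)
      omega
  · rintro (⟨he, h⟩ | ⟨he, h⟩ | ⟨l, hl, h⟩)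
    · have h0 : nC k w = 0 := by unfold nC; rw [he, Finset.card_empty]
      omega
    · have h0 : nC k w = 0 := by unfold nC; rw [he, Finset.card_empty]
      omega
    · have h0 : nC k w = 1 := by unfold nC; rw [hl, Finset.card_singleton]
      omega

/-- **the tail counts at the sub-top level** `u + v + 1 = k`:
`|E(u,v)| = A·(C(k,v) + C(k,v+1)) + Γ̃·C(k−1,v)` -/
theorem tailCount_subtop (hX : ∀ i, FlowOne (X i)) (u v : ℕ) (hk : u + v + 1 = k) :
    (tailCount (parFin k X) u v : ℚ)
      = massA k X * ((k.choose v : ℚ) + k.choose (v + 1)) + massG k X * ((k - 1).choose v : ℚ) := by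
  rw [tailCount_parFin_eq_sum k X hX]
  push_cast
  -- split the indicator of the tail into the three fibres
  have hsplit : ∀ w : Fin k → Ltr, (if u ≤ nR k w ∧ v ≤ nB k w then ((blockOf k X w).card : ℚ) else 0)
      = (if cSet k w = ∅ ∧ nB k w = v then ((blockOf k X w).card : ℚ) else 0)
        + (if cSet k w = ∅ ∧ nB k w = v + 1 then ((blockOf k X w).card : ℚ) else 0)
        + ∑ l, (if cSet k w = {l} ∧ nB k w = v then ((blockOf k X w).card : ℚ) else 0) := by
    intro w
    have hiff := subtop_cases k u v hk w
    by_cases h1 : cSet k w = ∅ ∧ nB k w = v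
    · rw [if_pos (hiff.2 (Or.inl h1)), if_pos h1, if_neg (fun h => by omega)]
      rw [Finset.sum_eq_zero (fun l _ => if_neg (fun h => by
        have := h.1; rw [h1.1] at this; exact absurd this.symm (Finset.singleton_ne_empty l)))]
      ring
    · rw [if_neg h1]
      by_cases h2 : cSet k w = ∅ ∧ nB k w = v + 1
      · rw [if_pos (hiff.2 (Or.inr (Or.inl h2))), if_pos h2]
        rw [Finset.sum_eq_zero (fun l _ => if_neg (fun h => by
          have := h.1; rw [h2.1] at this; exact absurd this.symm (Finset.singleton_ne_empty l)))]
        ring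
      · rw [if_neg h2, zero_add, zero_add]
        by_cases h3 : ∃ l, cSet k w = {l} ∧ nB k w = v
        · obtain ⟨l, hl⟩ := h3
          rw [if_pos (hiff.2 (Or.inr (Or.inr ⟨l, hl⟩))), Finset.sum_eq_single l]
          · rw [if_pos hl]
          · intro l' _ hl'
            rw [if_neg]
            rintro ⟨h, -⟩
            rw [hl.1] at h
            exact hl' (Finset.singleton_inj.1 h).symm
          · intro h; exact absurd (Finset.mem_univ l) h
        · rw [if_neg (fun h => (hiff.1 h).elim h1 (fun h => h.elim h2 h3))]
          symm
          apply Finset.sum_eq_zero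
          intro l _
          exact if_neg (fun h => h3 ⟨l, h⟩)
  have hl : ∀ l : Fin k, ∑ w, (if cSet k w = {l} ∧ nB k w = v then ((blockOf k X w).card : ℚ) else 0)
      = ((k - 1).choose v : ℚ) * (((cellSet (X l)).card : ℚ) * ∏ i ∈ ({l} : Finset (Fin k))ᶜ, ((rSet (X i)).card : ℚ)) := by
    intro l
    rw [← Finset.sum_filter, sum_fibre, Finset.card_singleton, Finset.prod_singleton]
  rw [Finset.sum_filter, Finset.sum_congr rfl (fun w _ => hsplit w), Finset.sum_add_distrib, Finset.sum_add_distrib,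
    ← Finset.sum_filter, ← Finset.sum_filter, sum_fibre, sum_fibre, Finset.sum_comm,
    Finset.sum_congr rfl (fun l _ => hl l)]
  simp only [Finset.card_empty, Nat.sub_zero, Finset.prod_empty, one_mul, Finset.compl_empty]
  unfold massA massG
  rw [← Finset.mul_sum]
  ring

end SubTop

end Summit.Ventures.PercRepro2.Tail2D
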